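import Summits.CriticalPhenomena.SAWScalingLimit.Theorems.SAWDevelopingMapObservableToSLETypeLadderCarvedReductionSqueezeEscape
import Summits.CriticalPhenomena.SAWScalingLimit.Theorems.SAWDevelopingMapObservableToSLECanonicalTransferInner
import HarnessLib

/-!
# The two-piece inner domain at a fixed mesh (piece (G2-fam-c) of stub T2b″)

Crux `SAWDevelopingMap.ObservableToSLE` (stmt-CriticalPhenomena-10472), line `six-class-type-ladder`,
stub T2b″ `stub_carvedReduction_squeezeSolid`.  Landing target:
`Summits/CriticalPhenomena/SAWScalingLimit/Theorems/SAWDevelopingMapObservableToSLETypeLadderCarvedReductionSqueezeInner.lean`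
(`--supports stmt-CriticalPhenomena-10472`).  Sequel of `…SqueezeEscape` (p132758).

From the flatness-free two-piece escape lemma (`twoPiece_exists_pathIn_escape`: every non-deep
vertex escapes outside the deep set `S` to norm `≥ R + 5δ`) this file derives, exactly as the floor
line does (`FloorRatio.exists_inner_finset`), that at a fixed mesh the `S`-component of any vertex
`v₀` is (the vertex set of) a FINITE, SIMPLY CONNECTED and CONNECTED hexagonal-lattice domain:

* `twoPiece_exists_pathIn_compl_component` — every vertex outside the component escapes around it
  (a deep vertex of another component first descends to its first non-deep vertex);
* `twoPiece_exists_inner_finset` — the component is its own fill with respect to the far set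
  `{‖·‖ ≥ R + 5δ}` (`FloorRatio.exists_fill`, `FloorRatio.pathIn_far`); registered as
  `stub_carvedReduction_twoPieceInner`;
* `twoPiece_pathIn_of_deep_walk` — a walk whose closed `r`-discs lie in `Ω` and avoiding the
  excluded zones runs through `S` (the input of the compact exhaustion of the family).

Sources: H. Duminil-Copin, S. Smirnov, Ann. of Math. 175 (2012) §3; G. Grimmett, Percolation (1999) §1.6.
-/

noncomputable section

open scoped Topology
open Filter Set Metric
open Literature.Probability.LatticeModels (HexVertex hexGraph hexCenter Site)
open Literature.Probability.RandomPlanarGeometry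
open Literature.Probability.RandomPlanarGeometry.SAW
open Literature.Probability.Percolation (PathIn hexCenter_im hexCenter_re)

namespace Summit.CriticalPhenomena.SAWScalingLimit.Theorems.ObservableToSLE.TypeLadder

open Summit.CriticalPhenomena.SAWScalingLimit.Theorems.ObservableToSLE.FloorRatio
open Summit.CriticalPhenomena.SAWScalingLimit.Theorems.ObservableToSLE.Negative (finite_embMeshVertices_hex)

section TwoPieceInner

variable {Ω X : Set ℂ} {δ r R : ℝ} {S : Set HexVertex}
  {p : Fin 2 → ℂ} {ρₓ ρc ρc' σ D : ℝ} {μ mlo : Fin 2 → ℤ}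

/-- **Escape from outside the main component** (two-piece form).  With `S` exactly the set of deep
vertices, every vertex outside the `S`-component of `v₀` is joined, avoiding that component, to a
vertex of norm `≥ R + 5δ`: a non-deep vertex by the escape lemma; a deep vertex of another
component by descending far (below `-R - 5δ`, where nothing is deep) up to its first non-deep
vertex (the initial piece stays in its own component) followed by the escape lemma. -/
theorem twoPiece_exists_pathIn_compl_component (hδ : 0 < δ) (hr : 9 * δ ≤ r) (hR0 : 0 ≤ R)
    (hR : ∀ z ∈ Ω, ‖z‖ < R) (hE : IsConnected (closure Ω)ᶜ) (hEfr : frontier (closure Ω)ᶜ = frontier Ω)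
    (hρc : 3 * δ ≤ ρc) (hρcₓ : ρc ≤ ρₓ) (hρc' : 8 * δ ≤ ρc') (hσD : σ + 10 * δ ≤ D) (hσ : 0 ≤ σ)
    (hS : ∀ u, u ∈ S ↔ ((δ : ℂ) * hexCenter u ∈ Ω ∧
      (∀ i, ¬ (|((δ : ℂ) * hexCenter u).re - (p i).re| < ρₓ ∧ mlo i ≤ u.1 1 ∧ u.1 1 < μ i)) ∧
      closedBall ((δ : ℂ) * hexCenter u) r ⊆ Ω ∪ X))
    (hX : ∀ z ∈ X, ∃ i, |z.re - (p i).re| ≤ ρₓ - 10 * δ ∧ (p i).im - σ ≤ z.im ∧ z.im ≤ (p i).im)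
    (hB : ∀ i (z : ℂ), |z.re - (p i).re| ≤ ρc → (p i).im - ρc' ≤ z.im → z.im ≤ (p i).im → z ∉ Ω)
    (hμ : ∀ i (u : HexVertex), ((δ : ℂ) * hexCenter u).im ≤ (p i).im → u.1 1 < μ i)
    (hmlo : ∀ i (u : HexVertex), (p i).im - D ≤ ((δ : ℂ) * hexCenter u).im → mlo i ≤ u.1 1)
    (hzone : ∀ i (u : HexVertex), mlo i ≤ u.1 1 → (p i).im - ρc' + 8 * δ ≤ ((δ : ℂ) * hexCenter u).im)
    (v₀ : HexVertex) {z : HexVertex} (hz : ¬ PathIn hexGraph S v₀ z) :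
    ∃ w : HexVertex, R + 5 * δ ≤ ‖(δ : ℂ) * hexCenter w‖ ∧
      PathIn hexGraph {x | PathIn hexGraph S v₀ x}ᶜ z w := by
  set G : Set HexVertex := {x | PathIn hexGraph S v₀ x} with hG
  have hS' : ∀ u ∈ S, (δ : ℂ) * hexCenter u ∈ Ω ∧
      (∀ i, ¬ (|((δ : ℂ) * hexCenter u).re - (p i).re| < ρₓ ∧ mlo i ≤ u.1 1 ∧ u.1 1 < μ i)) ∧
      closedBall ((δ : ℂ) * hexCenter u) r ⊆ Ω ∪ X := fun u hu => (hS u).1 hu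
  have hGS : Sᶜ ⊆ Gᶜ := fun x hx hxG => hx hxG.right_mem
  have hesc : ∀ b : HexVertex, b ∉ S → ∃ w : HexVertex, R + 5 * δ ≤ ‖(δ : ℂ) * hexCenter w‖ ∧
      PathIn hexGraph Gᶜ b w := by
    intro b hb
    obtain ⟨w, hw, hbw⟩ := twoPiece_exists_pathIn_escape hδ hr hR0 hR hE hEfr hρc hρcₓ hρc' hσD hσ hS'
      hX hB hμ hmlo hzone (v := b) fun h' => hb ((hS b).2 h')
    exact ⟨w, hw, hbw.mono hGS⟩
  by_cases hzS : z ∈ S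
  · -- descend far, to the first non-deep vertex
    obtain ⟨w₀, q, hw₀, -⟩ := exists_walk_down hδ z
      (L := R + 6 * δ + |((δ : ℂ) * hexCenter z).im|) (by positivity)
    have hw₀S : w₀ ∉ S := by
      intro h'
      have h1 := hR _ (hS' w₀ h').1
      have h2 : -((δ : ℂ) * hexCenter w₀).im ≤ ‖(δ : ℂ) * hexCenter w₀‖ :=
        (neg_le_abs _).trans (Complex.abs_im_le_norm _)
      have h3 := le_abs_self ((δ : ℂ) * hexCenter z).im
      linarith
    have hzw₀ : PathIn hexGraph univ z w₀ := pathIn_of_walk q fun _ _ => mem_univ _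
    obtain ⟨a, b, -, hbS, -, hab, hza⟩ := hzw₀.exit (R := S) hzS hw₀S
    have hza' : PathIn hexGraph S z a := hza.mono inter_subset_left
    have hcomp : {x | PathIn hexGraph S z x} ⊆ Gᶜ := fun x hx hxG => hz (hxG.trans hx.symm)
    have hzaG : PathIn hexGraph Gᶜ z a := (pathIn_component hza').mono hcomp
    obtain ⟨w, hw, hbw⟩ := hesc b hbS
    exact ⟨w, hw, (hzaG.tail hab (hGS hbS)).trans hbw⟩
  · exact hesc z hzS

/-- **The two-piece inner domain at a fixed mesh.**  With `S` exactly the set of deep vertices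
(and `Ω ⊆ B(0, R)`), the `S`-component of any vertex `v₀` is (the vertex set of) a finite, SIMPLY
CONNECTED and CONNECTED hexagonal-lattice domain: it is its own fill with respect to the far set
`{‖·‖ ≥ R + 5δ}`, every other vertex escaping to that far set around it. -/
theorem twoPiece_exists_inner_finset (hδ : 0 < δ) (hr : 9 * δ ≤ r) (hR0 : 0 ≤ R)
    (hR : ∀ z ∈ Ω, ‖z‖ < R) (hE : IsConnected (closure Ω)ᶜ) (hEfr : frontier (closure Ω)ᶜ = frontier Ω)
    (hρc : 3 * δ ≤ ρc) (hρcₓ : ρc ≤ ρₓ) (hρc' : 8 * δ ≤ ρc') (hσD : σ + 10 * δ ≤ D) (hσ : 0 ≤ σ)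
    (hS : ∀ u, u ∈ S ↔ ((δ : ℂ) * hexCenter u ∈ Ω ∧
      (∀ i, ¬ (|((δ : ℂ) * hexCenter u).re - (p i).re| < ρₓ ∧ mlo i ≤ u.1 1 ∧ u.1 1 < μ i)) ∧
      closedBall ((δ : ℂ) * hexCenter u) r ⊆ Ω ∪ X))
    (hX : ∀ z ∈ X, ∃ i, |z.re - (p i).re| ≤ ρₓ - 10 * δ ∧ (p i).im - σ ≤ z.im ∧ z.im ≤ (p i).im)
    (hB : ∀ i (z : ℂ), |z.re - (p i).re| ≤ ρc → (p i).im - ρc' ≤ z.im → z.im ≤ (p i).im → z ∉ Ω)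
    (hμ : ∀ i (u : HexVertex), ((δ : ℂ) * hexCenter u).im ≤ (p i).im → u.1 1 < μ i)
    (hmlo : ∀ i (u : HexVertex), (p i).im - D ≤ ((δ : ℂ) * hexCenter u).im → mlo i ≤ u.1 1)
    (hzone : ∀ i (u : HexVertex), mlo i ≤ u.1 1 → (p i).im - ρc' + 8 * δ ≤ ((δ : ℂ) * hexCenter u).im)
    (v₀ : HexVertex) :
    ∃ Λ : Finset HexVertex, hexDomainSimplyConnected Λ ∧
      (hexGraph.induce (↑Λ : Set HexVertex)).Preconnected ∧
      ∀ z : HexVertex, z ∈ Λ ↔ PathIn hexGraph S v₀ z := by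
  set G : Set HexVertex := {x | PathIn hexGraph S v₀ x} with hG
  set F : Set HexVertex := {w | R + 5 * δ ≤ ‖(δ : ℂ) * hexCenter w‖} with hF
  have hS' : ∀ u ∈ S, (δ : ℂ) * hexCenter u ∈ Ω := fun u hu => ((hS u).1 hu).1
  have hGnorm : ∀ x ∈ G, ‖(δ : ℂ) * hexCenter x‖ < R := fun x hx => hR _ (hS' x hx.right_mem)
  -- `G` is connected through itself
  have hGG : ∀ x ∈ G, ∀ y ∈ G, PathIn hexGraph G x y := fun x hx y hy =>
    (pathIn_component (hx.symm.trans hy)).mono fun u hu => hx.trans hu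
  -- the far set has finite complement
  have hfin : Fᶜ.Finite := by
    refine (finite_embMeshVertices_hex (isBounded_ball (x := (0 : ℂ)) (r := R + 5 * δ))
      hδ.ne').subset fun w hw => ?_
    simp only [hF, mem_compl_iff, mem_setOf_eq, not_le] at hw
    rw [mem_embMeshVertices_iff, mem_ball_zero_iff]
    exact hw
  -- far vertices are joined avoiding `G`
  have hFF : ∀ w₁ ∈ F, ∀ w₂ ∈ F, PathIn hexGraph Gᶜ w₁ w₂ := fun w₁ hw₁ w₂ hw₂ =>
    pathIn_far hδ hR0 hGnorm hw₁ hw₂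
  -- every vertex reaches the far set (straight down)
  have hreach : ∀ z : HexVertex, ∃ w ∈ F, PathIn hexGraph univ z w := by
    intro z
    obtain ⟨w, q, hw, -⟩ := exists_walk_down hδ z
      (L := R + 6 * δ + |((δ : ℂ) * hexCenter z).im|) (by positivity)
    refine ⟨w, ?_, pathIn_of_walk q fun _ _ => mem_univ _⟩
    have h2 : -((δ : ℂ) * hexCenter w).im ≤ ‖(δ : ℂ) * hexCenter w‖ :=
      (neg_le_abs _).trans (Complex.abs_im_le_norm _)
    have h3 := le_abs_self ((δ : ℂ) * hexCenter z).im
    show R + 5 * δ ≤ ‖(δ : ℂ) * hexCenter w‖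
    linarith
  obtain ⟨Λ, hGΛ, hsc, hconn, hmem⟩ := exists_fill hGG hfin hFF hreach
  refine ⟨Λ, hsc, hconn, fun z => ⟨fun hz => ?_, fun hz => hGΛ hz⟩⟩
  by_contra hzG
  obtain ⟨w, hw, hzw⟩ := twoPiece_exists_pathIn_compl_component hδ hr hR0 hR hE hEfr hρc hρcₓ hρc'
    hσD hσ hS hX hB hμ hmlo hzone v₀ hzG
  exact (hmem z).1 hz ⟨w, hw, hzw⟩

/-- **Deep walks run through `S`.**  A walk all of whose vertices have their closed `r`-disc in `Ω`
(`0 ≤ r`) and lie outside the excluded zones is a `PathIn` chain inside the deep set `S`. -/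
theorem twoPiece_pathIn_of_deep_walk (hr : 0 ≤ r)
    (hS : ∀ u, u ∈ S ↔ ((δ : ℂ) * hexCenter u ∈ Ω ∧
      (∀ i, ¬ (|((δ : ℂ) * hexCenter u).re - (p i).re| < ρₓ ∧ mlo i ≤ u.1 1 ∧ u.1 1 < μ i)) ∧
      closedBall ((δ : ℂ) * hexCenter u) r ⊆ Ω ∪ X))
    {v w : HexVertex} (q : hexGraph.Walk v w)
    (hq : ∀ u ∈ q.support, closedBall ((δ : ℂ) * hexCenter u) r ⊆ Ω)
    (hqz : ∀ u ∈ q.support, ∀ i,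
      ¬ (|((δ : ℂ) * hexCenter u).re - (p i).re| < ρₓ ∧ mlo i ≤ u.1 1 ∧ u.1 1 < μ i)) :
    PathIn hexGraph S v w :=
  pathIn_of_walk q fun u hu => (hS u).2 ⟨hq u hu (mem_closedBall_self hr), hqz u hu,
    (hq u hu).trans fun _ hx => Or.inl hx⟩

/-- **Registered sub-goal `stub_carvedReduction_twoPieceInner`** (crux item
stmt-CriticalPhenomena-10472, stub T2b″ `stub_carvedReduction_squeezeSolid`, piece (G2-fam-c) THE
TWO-PIECE INNER DOMAIN AT A FIXED MESH): registry form of `twoPiece_exists_inner_finset`. -/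
theorem stub_carvedReduction_twoPieceInner :
    ∀ (Ω X : Set ℂ) (p : Fin 2 → ℂ) (δ r R ρₓ ρc ρc' σ D : ℝ) (μ mlo : Fin 2 → ℤ) (S : Set HexVertex)
      (v₀ : HexVertex),
      0 < δ → 9 * δ ≤ r → 0 ≤ R → (∀ z ∈ Ω, ‖z‖ < R) → IsConnected (closure Ω)ᶜ →
      frontier (closure Ω)ᶜ = frontier Ω →
      3 * δ ≤ ρc → ρc ≤ ρₓ → 8 * δ ≤ ρc' → σ + 10 * δ ≤ D → 0 ≤ σ →
      (∀ u, u ∈ S ↔ ((δ : ℂ) * hexCenter u ∈ Ω ∧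
        (∀ i, ¬ (|((δ : ℂ) * hexCenter u).re - (p i).re| < ρₓ ∧ mlo i ≤ u.1 1 ∧ u.1 1 < μ i)) ∧
        closedBall ((δ : ℂ) * hexCenter u) r ⊆ Ω ∪ X)) →
      (∀ z ∈ X, ∃ i, |z.re - (p i).re| ≤ ρₓ - 10 * δ ∧ (p i).im - σ ≤ z.im ∧ z.im ≤ (p i).im) →
      (∀ i (z : ℂ), |z.re - (p i).re| ≤ ρc → (p i).im - ρc' ≤ z.im → z.im ≤ (p i).im → z ∉ Ω) →
      (∀ i (u : HexVertex), ((δ : ℂ) * hexCenter u).im ≤ (p i).im → u.1 1 < μ i) →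
      (∀ i (u : HexVertex), (p i).im - D ≤ ((δ : ℂ) * hexCenter u).im → mlo i ≤ u.1 1) →
      (∀ i (u : HexVertex), mlo i ≤ u.1 1 → (p i).im - ρc' + 8 * δ ≤ ((δ : ℂ) * hexCenter u).im) →
      ∃ Λ : Finset HexVertex, hexDomainSimplyConnected Λ ∧
        (hexGraph.induce (↑Λ : Set HexVertex)).Preconnected ∧
        ∀ z : HexVertex, z ∈ Λ ↔ PathIn hexGraph S v₀ z :=
  fun _ _ _ _ _ _ _ _ _ _ _ _ _ _ v₀ hδ hr hR0 hR hE hEfr hρc hρcₓ hρc' hσD hσ hS hX hB hμ hmlo hzone =>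
    twoPiece_exists_inner_finset hδ hr hR0 hR hE hEfr hρc hρcₓ hρc' hσD hσ hS hX hB hμ hmlo hzone v₀

end TwoPieceInner

end Summit.CriticalPhenomena.SAWScalingLimit.Theorems.ObservableToSLE.TypeLadder

end
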